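import Mathlib
import Summits.Ventures.PercRepro2.CoinOrTailKDefs
import Summits.Ventures.PercRepro2.CoinChainTower
import Summits.Ventures.PercRepro2.CoinTowerFunnelCoins

/-!
# The funnel at a tower vertex with random coins above: an instantiation, no hypothesis
(blind cell PercRepro2, night-2 g18; NIGHT2-DARC.md §58.11)

Twelve coins on `Fin 9` (s = 0, m = 1, q = 2, v = 3, u = 4, a = 5, h = 6, w = 7, t = 8): the core
`{m, q}` (`s → m`, `s → q`, `m → q` — a cycle-free but otherwise unstructured core; no
log-supermodularity is used), the tower vertex `v` entered from `m` and `q` by SURE coins, `u`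
entered from `v` (random), `a` entered from `u` and `v` (random), the head `a → t`, `u → h → t`,
`q → h`, `w → t`.  Every route into `a` passes through `v`: row 2′DARC at `a → w` for the markers
`(v, a)` for EVERY probability vector with the two `v`-coins sure
(`darc_towerFunnel_coins_example`).
-/

namespace Summit.Ventures.PercRepro2.Coin

namespace FunnelCoinsExample

open Classical

/-- The twelve coins of the example. -/
def arcsFC : Fin 12 → Finset (Fin 9 × Fin 9)
  | 0 => {(0, 1)}   -- s → m
  | 1 => {(0, 2)}   -- s → q
  | 2 => {(1, 2)}   -- m → q
  | 3 => {(1, 3)}   -- m → v (sure)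
  | 4 => {(2, 3)}   -- q → v (sure)
  | 5 => {(3, 4)}   -- v → u
  | 6 => {(4, 5)}   -- u → a
  | 7 => {(3, 5)}   -- v → a
  | 8 => {(5, 8)}   -- a → t
  | 9 => {(4, 6)}   -- u → h
  | 10 => {(6, 8)}  -- h → t
  | 11 => {(7, 8)}  -- w → t
  | _ => ∅

/-- The entry coins of `v`. -/
def cvFC : Fin 9 → Fin 12
  | 1 => 3
  | 2 => 4
  | _ => 0

/-- The entry coin of `u`. -/
def cuFC : Fin 9 → Fin 12
  | 3 => 5
  | _ => 0

/-- The entry coins of `a`. -/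
def cFC : Fin 9 → Fin 12
  | 4 => 6
  | 3 => 7
  | _ => 0

/-- Every coin is a single arc. -/
lemma sameEnds_fc : SameEnds arcsFC := by
  intro e xy hxy x'y' hx'y'
  fin_cases e <;> simp [arcsFC] at hxy hx'y' <;> subst hxy <;> subst hx'y' <;>
    exact ⟨Or.inl rfl, Or.inr rfl⟩

set_option maxRecDepth 20000 in
/-- `v = 3` is an OR-vertex of the core `{m, q}` entered from `m, q`. -/
lemma orTailK_v : OrTailK arcsFC 0 {1, 2} {1, 2} cvFC 3 where
  ent_sub := by decide
  s_notin := by decide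
  a_notin := by decide
  a_ne_s := by decide
  into_U := by decide
  into_s := by decide
  into_a := by decide
  arcs_c := by decide
  c_inj := by decide

set_option maxRecDepth 20000 in
/-- `u = 4` is an OR-vertex of `{m, q, v}` entered from `v`. -/
lemma orTailK_u : OrTailK arcsFC 0 (insert 3 {1, 2}) {3} cuFC 4 where
  ent_sub := by decide
  s_notin := by decide
  a_notin := by decide
  a_ne_s := by decide
  into_U := by decide
  into_s := by decide
  into_a := by decide
  arcs_c := by decide
  c_inj := by decide

set_option maxRecDepth 20000 in
/-- `a = 5` is an OR-vertex of `{m, q, v, u}` entered from `u` and `v`. -/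
lemma orTailK_a : OrTailK arcsFC 0 (insert 4 (insert 3 {1, 2})) {4, 3} cFC 5 where
  ent_sub := by decide
  s_notin := by decide
  a_notin := by decide
  a_ne_s := by decide
  into_U := by decide
  into_s := by decide
  into_a := by decide
  arcs_c := by decide
  c_inj := by decide

/-- The upper tower `[u]` over `{m, q, v}`. -/
lemma orTower_up : OrTower arcsFC 0 (insert 3 {1, 2}) [({3}, cuFC, 4)] :=
  OrTower.cons _ _ _ _ _ orTailK_u (OrTower.nil _)

/-- **Row 2′DARC at `a → w` for the markers `(v, a)` on the twelve-coin instance, every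
probability vector with the two entry coins of `v` sure — no other hypothesis.** -/
theorem darc_towerFunnel_coins_example {R : Type*} [Field R] [LinearOrder R]
    [IsStrictOrderedRing R] (pr : Fin 12 → R) (hp : IsProbVec pr) (h3 : pr 3 = 1) (h4 : pr 4 = 1) :
    DARC pr arcsFC 0 {8} 3 5 5 7 :=
  darc_of_towerFunnel_coins (low := []) pr hp sameEnds_fc (OrTower.nil _)
    (fun _ hx => absurd hx List.not_mem_nil) orTailK_v
    (by
      intro r hr
      simp only [Finset.mem_insert, Finset.mem_singleton] at hr
      rcases hr with rfl | rfl
      · exact h3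
      · exact h4)
    orTower_up orTailK_a
    (by
      intro x hx
      simp only [List.mem_cons, List.not_mem_nil, or_false] at hx
      subst hx; decide)
    (by decide) (by decide) (by decide) (by decide) (by decide)

end FunnelCoinsExample

end Summit.Ventures.PercRepro2.Coin
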